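import Summits.BirchSwinnertonDyer.BirchSwinnertonDyer.Theorems.ThetaPartnerAtTwoSignedMainConjectureCMTwoRankZeroPTDeepCoindShapiro
import Literature.NumberTheory.EllipticCurves.CyclotomicLayerPairingOfFun
import HarnessLib

/-!
# The local Shapiro dictionary at `v ∣ p`, the self-duality transport and the dual transport for `Maps(Γ_ℚ ⧸ Γ_n, M)` — for an ARBITRARY
# finite discrete Galois module `M` with a non-degenerate pairing `e : M × M → μ_N`, in the `CyclotomicLayerPairingOfFun` currency
# (the `ρM`-generic twin of `…SignedMainConjectureCMTwoRankZeroPTDeepCoindShapiro.lean`, there `M = E[N]`, `e` = Weil)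

Route `ResidualThetaTransportAtTwo` (RTT), crux RSL_g `ResidualSignedLambdaLowerCMAtTwo` (stmt-BirchSwinnertonDyer-22608); seat
`prover-bsd-wall-tp2-p2x` g17 (`--supports 22608 --as helper`, closes nothing). THEOREMS ONLY (no definition, no named fact, no instance
declaration, no `sorry`). STUB-PLAN rev 16 S66 (5) «self-duality transport, SHARED with item 6» and N4 «local preimage by local Tate duality»:
the deep-half stubs of `Lines/onepair.lean` run Poitou–Tate for `ρc := Maps(Γ_ℚ ⧸ Γ_n, A_ρ[2^k])` and read its local terms at `v = 2` through
the PINNED layer pairing `rhoLayerPairingPk = layerPairingH1Of (cofreeTorsionGaloisModule S ρ (2^k)) (2^k) (ePk k) …` — i.e. exactly the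
currency of `CyclotomicLayerPairingOfFun.lean` with `M := A_ρ[2^k]`, `e := ePk k` (K-a's self-duality tower). This file supplies, for ANY
such `(M, e)`:

## Setting
`M` finite discrete with `ρM : DiscreteGaloisModule ℚ M`, `N ≥ 1`, `e : M × M → μ_N` bi-additive and Galois-equivariant (`hμ`, `hadd₁`,
`hadd₂`, `hgal`), NON-DEGENERATE on the right (`hnondeg`) and `N • M = 0` (`hN`) where needed; the cyclotomic `ℤ_p`-tower `κ` (`hκ`), a place
`v ∣ p` (`hv`; ONE ORBIT: `θ̄ : Γ_v ⧸ U_n → Γ_ℚ ⧸ Γ_n` is bijective, K3's `quotientPull_layerGroup_bijective`); `ρc := ρM.coind Γ_n`,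
`Ψ := coindTateDualMor ρM ρM Γ_n (pairingHomOfFun …)` (summed duality `ρc ⟶ ρc^D`), `Sh := shapiroLift ρM.toTopRep Γ_n …`,
`pull_v := H¹(coindFinPull)`, and the layer objects `layerLocOf`, `layerShapiroOf`, `layerSumPairingOf`, `layerPairingH1Of`, `invAt`.

## What is proved
* §1 `cohomologyMap_coindFinPull_localization_shapiroLift` — **`pull_v (loc_v (Sh a)) = layerShapiroOf (layerLocOf a)`**.
* §2 `localTatePairingZMod_canonical_localization_coindTateDual_shapiroLift` — **`⟨a', loc_v (H¹(Ψ)(Sh b))⟩_v = invAt_v (pull_v a' ∪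
  layerShapiroOf (layerLocOf b))`** for THE canonical invariant maps; `…_shapiroLift_shapiroLift` — both classes global:
  `⟨loc_v (Sh a), loc_v (H¹(Ψ)(Sh b))⟩_v = layerPairingH1Of … (layerLocOf a) (layerLocOf b)`.
* §3 `injective_pairingHomOfFun_flip` / `bijective_pairingHomOfFun_flip` (`M ⥲ M^D` for `e` non-degenerate, `N • M = 0`),
  `bijective_cohomologyMap_coindFinPull` (`pull_v` bijective at `v ∣ p`), `existsUnique_shapiroLift_coindTateDual_eq` (every
  `y ∈ H¹(ℚ, ρc^D)` is `H¹(Ψ)(Sh b)` for a unique layer class `b`), `exists_injective_dualTransport` (the dual transport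
  `T_v : H¹(Γ_v, Maps(Γ_v ⧸ U_n, M|)) ↪ H¹(ℚ_v, ρc^D)` with `⟨a', T_v t⟩_v = invAt_v (pull_v a' ∪ t)`),
  `eq_zero_of_forall_invAt_cupProduct_pull_eq_zero` (NON-DEGENERACY of the layer pairing at `v ∣ p` = local Tate duality for `ℚ_{n,v}`
  in the Shapiro model, from `LocalInvariants.canonical_isPerfect` on `ρc`).

Proofs VERBATIM those of the `E[N]` file with `W.torsionGaloisModule N ↦ ρM`, `weilPairingHom ↦ pairingHomOfFun`, `weilContPairing ↦
contPairingOfFun`, `torsionLocalRep ↦ localRepOf`, `layerLoc/layerShapiro/layerSumPairing ↦ layerLocOf/layerShapiroOf/layerSumPairingOf`;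
compactness of the two absolute Galois groups and finiteness of `M` are INSTANCE BINDERS (no local instance attribute).

References: [NeukirchSchmidtWingberg2008] I §5 Prop. (1.5.3)(iv), I §6 (1.6.4)–(1.6.5); [MilneADT2006] I Cor. 2.3, Thm. 2.6, I §6 (proof of
Prop. 6.9); [Kobayashi2003] (8.23) (p. 18). BSD is not proved by any of this; RSL_g (22608) is not proved here.
-/

set_option autoImplicit false
-- the Theorems namespace of this sub repeats the summit name by design (D-0017 nested layout)
set_option linter.dupNamespace false

noncomputable section

open scoped Classical

namespace Summit.BirchSwinnertonDyer.BirchSwinnertonDyer.Theorems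

namespace ThetaTransport.CoindShapiroOfFun

open CategoryTheory Field NumberField IsDedekindDomain
  Literature.NumberTheory.EllipticCurves Literature.NumberTheory.EllipticCurves.CyclotomicLayer
  Literature.NumberTheory.GaloisRepresentations Literature.NumberTheory.GaloisRepresentations.DiscreteGaloisModule
  Literature.NumberTheory.GaloisCohomology ZpExtension
open SignedLowerOffTwo.PTDeep (bijective_cohomologyMap_of_bijective)

variable {M : Type} [AddCommGroup M] [TopologicalSpace M] [DiscreteTopology M]
  (ρM : DiscreteGaloisModule ℚ M) (N : ℕ) [NeZero N]
  (e : M → M → AlgebraicClosure ℚ)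
  (hμ : ∀ S T, e S T ^ N = 1)
  (hadd₁ : ∀ S₁ S₂ T, e (S₁ + S₂) T = e S₁ T * e S₂ T)
  (hadd₂ : ∀ S T₁ T₂, e S (T₁ + T₂) = e S T₁ * e S T₂)
  (hgal : ∀ (σ : absoluteGaloisGroup ℚ) (S T : M), σ • e S T = e (ρM σ S) (ρM σ T))
  {p : ℕ} [Fact p.Prime] (κ : ZpExtension ℚ p) (v : HeightOneSpectrum (𝓞 ℚ)) (hκ : κ.IsCyclotomic) (hv : (p : 𝓞 ℚ) ∈ v.asIdeal)

/-! ## §1 `pull_v ∘ loc_v ∘ Sh = layerShapiroOf ∘ layerLocOf` -/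

omit [NeZero N] in
include hκ hv in
/-- **`pull_v (loc_v (Sh a)) = layerShapiroOf (layerLocOf a)`** for `a ∈ H¹(Γ_n, M)`: localising the global Shapiro lift of `a` to `ℚ_v`
(`galoisCohomology.localization` of `ρc = Maps(Γ_ℚ ⧸ Γ_n, M)`) and pulling back along `θ̄ : Γ_v ⧸ U_n → Γ_ℚ ⧸ Γ_n` (`coindFinPull`, identity
on `M`) gives the LAYER Shapiro lift of the layer localisation of `a` (generic `map_coindFinPull_shapiroLift`, one orbit at `v ∣ p`, with the
localisation split off on cocycles). [cite: NeukirchSchmidtWingberg2008, I §6 Prop. (1.6.4), (1.6.5)] -/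
theorem cohomologyMap_coindFinPull_localization_shapiroLift [CompactSpace (absoluteGaloisGroup ℚ)]
    [CompactSpace (absoluteGaloisGroup (v.adicCompletion ℚ))] (n : ℕ) [Fintype (absoluteGaloisGroup ℚ ⧸ κ.layerSubgroup n)]
    {s : absoluteGaloisGroup ℚ ⧸ κ.layerSubgroup n → absoluteGaloisGroup ℚ}
    (hs : ∀ y, (s y : absoluteGaloisGroup ℚ ⧸ κ.layerSubgroup n) = y)
    (hs1 : s ((1 : absoluteGaloisGroup ℚ) : absoluteGaloisGroup ℚ ⧸ κ.layerSubgroup n) = 1)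
    (a : H1 ρM (κ.layerSubgroup n)) :
    cohomologyMap (coindFinPull ρM.toTopRep (κ.layerSubgroup n)
        (resGalOfEmb (closureEmb (K := ℚ) (v.adicCompletion ℚ))) (X' := localRepOf ρM v)
        (TopRep.ofHom ⟨ContinuousLinearMap.id ℤ M, fun _ => rfl⟩) (layerGroup κ v n) (fun _ h => h)) 1
      (galoisCohomology.localization (ρM.coind (κ.layerSubgroup n) (κ.isOpen_layerSubgroup n)) (Sum.inr v) 1
        (shapiroLift ρM.toTopRep (κ.layerSubgroup n) (κ.isOpen_layerSubgroup n) hs hs1 a)) =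
      layerShapiroOf ρM κ v n (layerLocOf ρM κ v n a) := by
  have hlayer : ContinuousCohomology.map (resGalOfEmb (closureEmb (K := ℚ) (v.adicCompletion ℚ)))
        (coindFinPull ρM.toTopRep (κ.layerSubgroup n)
          (resGalOfEmb (closureEmb (K := ℚ) (v.adicCompletion ℚ))) (X' := localRepOf ρM v)
          (TopRep.ofHom ⟨ContinuousLinearMap.id ℤ M, fun _ => rfl⟩) (layerGroup κ v n) (fun _ h => h)) 1
        (shapiroLift ρM.toTopRep (κ.layerSubgroup n) (κ.isOpen_layerSubgroup n) hs hs1 a) =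
      layerShapiroOf ρM κ v n (layerLocOf ρM κ v n a) :=
    map_coindFinPull_shapiroLift ρM.toTopRep (κ.layerSubgroup n)
      (resGalOfEmb (closureEmb (K := ℚ) (v.adicCompletion ℚ))) (X' := localRepOf ρM v)
      (TopRep.ofHom ⟨ContinuousLinearMap.id ℤ M, fun _ => rfl⟩) (layerGroup κ v n) (fun _ h => h)
      (resGalSubgroupOfEmb (κ.layerSubgroup n) (closureEmb (K := ℚ) (v.adicCompletion ℚ))) (fun _ => rfl)
      (κ.isOpen_layerSubgroup n) (isOpen_layerGroup κ v n) hs hs1 (layerReps_spec κ v n) (layerReps_one κ v n)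
      (SignedKatoOffTwo.LayerPairing.quotientPull_layerGroup_bijective κ v hκ hv n) a
  rw [← hlayer]
  obtain ⟨F, hF⟩ := oneCocycleClass_surjective _
    (shapiroLift ρM.toTopRep (κ.layerSubgroup n) (κ.isOpen_layerSubgroup n) hs hs1 a)
  rw [← hF]
  change cohomologyMap _ 1 (ContinuousCohomology.map _ _ 1 (oneCocycleClass _ F)) = ContinuousCohomology.map _ _ 1 (oneCocycleClass _ F)
  rw [map_oneCocycleClass, cohomologyMap_oneCocycleClass, map_oneCocycleClass]
  rfl

/-! ## §2 The local Tate pairing of `ρc` at `v ∣ p` against `loc_v (H¹(Ψ)(Sh b))` is the layer cup product -/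

include hκ hv in
/-- **`⟨a', loc_v (H¹(Ψ)(Sh b))⟩_v = invAt_v (pull_v a' ∪_{layerSumPairingOf} layerShapiroOf (layerLocOf b))`** for THE canonical invariant
maps: for a LOCAL class `a' ∈ H¹(ℚ_v, Maps(Γ_ℚ ⧸ Γ_n, M))` and a layer class `b ∈ H¹(Γ_n, M)`, the local Tate pairing
(`localTatePairingZMod … (LocalInvariants.canonical ℚ N (Sum.inr v))`) of `a'` with the localisation of `H¹(Ψ)(Sh b)` is THE invariant of the
LAYER cup product of `pull_v a'` with `layerShapiroOf (layerLocOf b)`. Ingredients: `localization_cohomologyMap_coindTateDualMor`,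
`localTatePairing_coind_cohomologyMap_eq_cupProduct_pull` (one orbit at `v ∣ p`) and §1. [cite: MilneADT2006, Ch. I Cor. 2.3, Ch. I §6 (proof of Prop. 6.9)]
[cite: NeukirchSchmidtWingberg2008, I §5 Prop. (1.5.3)(iv), I §6 (1.6.5)] -/
theorem localTatePairingZMod_canonical_localization_coindTateDual_shapiroLift [Finite M] [CompactSpace (absoluteGaloisGroup ℚ)]
    [CompactSpace (absoluteGaloisGroup (v.adicCompletion ℚ))] (n : ℕ) [Fintype (absoluteGaloisGroup ℚ ⧸ κ.layerSubgroup n)]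
    {s : absoluteGaloisGroup ℚ ⧸ κ.layerSubgroup n → absoluteGaloisGroup ℚ}
    (hs : ∀ y, (s y : absoluteGaloisGroup ℚ ⧸ κ.layerSubgroup n) = y)
    (hs1 : s ((1 : absoluteGaloisGroup ℚ) : absoluteGaloisGroup ℚ ⧸ κ.layerSubgroup n) = 1)
    (a' : galoisCohomology ((ρM.coind (κ.layerSubgroup n) (κ.isOpen_layerSubgroup n)).toLocal (Sum.inr v)) 1)
    (b : H1 ρM (κ.layerSubgroup n)) :
    localTatePairingZMod (ρM.coind (κ.layerSubgroup n) (κ.isOpen_layerSubgroup n)) N (Sum.inr v)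
        (LocalInvariants.canonical ℚ N (Sum.inr v)) a'
        (galoisCohomology.localization ((ρM.coind (κ.layerSubgroup n) (κ.isOpen_layerSubgroup n)).tateDual N) (Sum.inr v) 1
          (cohomologyMap (coindTateDualMor ρM ρM (κ.layerSubgroup n) (pairingHomOfFun N e hμ hadd₁ hadd₂) (κ.isOpen_layerSubgroup n)
              (fun σ S T => (contPairingOfFun ρM N e hμ hadd₁ hadd₂ hgal).toLin_smul σ S T)) 1
            (shapiroLift ρM.toTopRep (κ.layerSubgroup n) (κ.isOpen_layerSubgroup n) hs hs1 b))) =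
      invAt N v ((layerSumPairingOf ρM N e hμ hadd₁ hadd₂ hgal κ v n).cupProduct
        (cohomologyMap (coindFinPull ρM.toTopRep (κ.layerSubgroup n)
          (resGalOfEmb (closureEmb (K := ℚ) (v.adicCompletion ℚ))) (X' := localRepOf ρM v)
          (TopRep.ofHom ⟨ContinuousLinearMap.id ℤ M, fun _ => rfl⟩) (layerGroup κ v n) (fun _ h => h)) 1 a')
        (layerShapiroOf ρM κ v n (layerLocOf ρM κ v n b))) := by
  rw [localTatePairingZMod_apply, localization_cohomologyMap_coindTateDualMor]
  -- the one-orbit data at `v ∣ p`, pre-elaborated in the `Place.Completion` spelling of the Literature lemma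
  have hU' : ∀ d : absoluteGaloisGroup (Place.Completion (Sum.inr v : Place ℚ)),
      d ∈ (layerGroup κ v n : Subgroup (absoluteGaloisGroup (Place.Completion (Sum.inr v : Place ℚ)))) →
        absGaloisRestrict ℚ (Place.Completion (Sum.inr v : Place ℚ)) d ∈ κ.layerSubgroup n := fun _ h => h
  have hbij : Function.Bijective (quotientPull (κ.layerSubgroup n) (absGaloisRestrict ℚ (Place.Completion (Sum.inr v : Place ℚ)))
      (layerGroup κ v n : Subgroup (absoluteGaloisGroup (Place.Completion (Sum.inr v : Place ℚ)))) hU') :=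
    SignedKatoOffTwo.LayerPairing.quotientPull_layerGroup_bijective κ v hκ hv n
  have key := @localTatePairing_coind_cohomologyMap_eq_cupProduct_pull ℚ _ _ _ _ _ _ _ _ _ _
    ρM ρM (κ.layerSubgroup n) _ N (pairingHomOfFun N e hμ hadd₁ hadd₂) (κ.isOpen_layerSubgroup n)
    (fun σ S T => (contPairingOfFun ρM N e hμ hadd₁ hadd₂ hgal).toLin_smul σ S T) _ (Sum.inr v) (layerGroup κ v n)
    hU' (layerFintypeQuot κ v n) hbij
  rw [key, ← cohomologyMap_coindFinPull_localization_shapiroLift ρM κ v hκ hv n hs hs1 b]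
  rfl

include hκ hv in
/-- **Both classes global: `⟨loc_v (Sh a), loc_v (H¹(Ψ)(Sh b))⟩_v = layerPairingH1Of … (layerLocOf a) (layerLocOf b)`** — the local term at
`v ∣ p` of Poitou–Tate for `Maps(Γ_ℚ ⧸ Γ_n, M)` and THE canonical maps IS the layer pairing of the layer localisations (§1 + the previous theorem +
`layerPairingH1Of_apply`). [cite: Kobayashi2003, (8.23) (p. 18)] [cite: MilneADT2006, Ch. I §6 (proof of Prop. 6.9)] -/
theorem localTatePairingZMod_canonical_localization_shapiroLift_shapiroLift [Finite M] [CompactSpace (absoluteGaloisGroup ℚ)]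
    [CompactSpace (absoluteGaloisGroup (v.adicCompletion ℚ))] (n : ℕ) [Fintype (absoluteGaloisGroup ℚ ⧸ κ.layerSubgroup n)]
    {s : absoluteGaloisGroup ℚ ⧸ κ.layerSubgroup n → absoluteGaloisGroup ℚ}
    (hs : ∀ y, (s y : absoluteGaloisGroup ℚ ⧸ κ.layerSubgroup n) = y)
    (hs1 : s ((1 : absoluteGaloisGroup ℚ) : absoluteGaloisGroup ℚ ⧸ κ.layerSubgroup n) = 1)
    (a b : H1 ρM (κ.layerSubgroup n)) :
    localTatePairingZMod (ρM.coind (κ.layerSubgroup n) (κ.isOpen_layerSubgroup n)) N (Sum.inr v)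
        (LocalInvariants.canonical ℚ N (Sum.inr v))
        (galoisCohomology.localization (ρM.coind (κ.layerSubgroup n) (κ.isOpen_layerSubgroup n)) (Sum.inr v) 1
          (shapiroLift ρM.toTopRep (κ.layerSubgroup n) (κ.isOpen_layerSubgroup n) hs hs1 a))
        (galoisCohomology.localization ((ρM.coind (κ.layerSubgroup n) (κ.isOpen_layerSubgroup n)).tateDual N) (Sum.inr v) 1
          (cohomologyMap (coindTateDualMor ρM ρM (κ.layerSubgroup n) (pairingHomOfFun N e hμ hadd₁ hadd₂) (κ.isOpen_layerSubgroup n)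
              (fun σ S T => (contPairingOfFun ρM N e hμ hadd₁ hadd₂ hgal).toLin_smul σ S T)) 1
            (shapiroLift ρM.toTopRep (κ.layerSubgroup n) (κ.isOpen_layerSubgroup n) hs hs1 b))) =
      layerPairingH1Of ρM N e hμ hadd₁ hadd₂ hgal κ v n (layerLocOf ρM κ v n a) (layerLocOf ρM κ v n b) := by
  rw [localTatePairingZMod_canonical_localization_coindTateDual_shapiroLift ρM N e hμ hadd₁ hadd₂ hgal κ v hκ hv n hs hs1,
    cohomologyMap_coindFinPull_localization_shapiroLift ρM κ v hκ hv n hs hs1 a, layerPairingH1Of_apply]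

/-! ## §3 Duality: `M ⥲ M^D`, `H¹(Ψ)`, `pull_v` are bijections; the dual transport; non-degeneracy of the layer pairing -/

omit [TopologicalSpace M] [DiscreteTopology M] in
/-- **`T ↦ e(·, T) : M → M^D` is injective** for `e` non-degenerate on the right. [cite: MilneADT2006, Ch. I §0 (pairings of `G`-modules)] -/
theorem injective_pairingHomOfFun_flip (hnondeg : ∀ T, (∀ S, e S T = 1) → T = 0) :
    Function.Injective fun T : M => (pairingHomOfFun N e hμ hadd₁ hadd₂).flip T := by
  intro T₁ T₂ h
  rw [← sub_eq_zero]
  refine hnondeg _ fun S => ?_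
  have hS := congrArg (fun φ : M →+ MuCarrier ℚ N => (((MuCarrier.toAdditive (φ S)).toMul : (AlgebraicClosure ℚ)ˣ) :
    AlgebraicClosure ℚ)) h
  simp only [AddMonoidHom.flip_apply, coe_pairingHomOfFun] at hS
  -- `e S (T₁ - T₂) * e S T₂ = e S T₁`
  have hsplit : e S (T₁ - T₂) * e S T₂ = e S T₁ := by rw [← hadd₂, sub_add_cancel]
  have hne : e S T₂ ≠ 0 := fun h0 => by
    have := hμ S T₂
    rw [h0, zero_pow (NeZero.ne N)] at this
    exact zero_ne_one this
  exact mul_right_cancel₀ hne (by rw [hsplit, one_mul, hS])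

omit [TopologicalSpace M] [DiscreteTopology M] in
/-- **The duality map `T ↦ e(·, T) : M → M^D` is bijective** for `e` non-degenerate on the right and `N • M = 0`: injective between finite
sets of the same size (`#Hom(M, μ_N) = #M`: `HomCarrier.natCard_eq`, `muEquivZMod`). [cite: MilneADT2006, Ch. I §0] -/
theorem bijective_pairingHomOfFun_flip [Finite M] (hnondeg : ∀ T, (∀ S, e S T = 1) → T = 0) (hN : ∀ m : M, N • m = 0) :
    Function.Bijective fun T : M => (pairingHomOfFun N e hμ hadd₁ hadd₂).flip T := by
  haveI : Finite (M →+ MuCarrier ℚ N) := DiscreteGaloisModule.TateDual.finite ℚ M N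
  exact (injective_pairingHomOfFun_flip N e hμ hadd₁ hadd₂ hnondeg).bijective_of_nat_card_le
    (le_of_eq (HomCarrier.natCard_eq (M := M) (muEquivZMod ℚ N) hN))

include hκ hv in
omit [NeZero N] in
/-- **`pull_v = H¹(coindFinPull)` is bijective at `v ∣ p`** (any degree): `φ ↦ φ ∘ θ̄` is a bijection `Maps(Γ_ℚ ⧸ Γ_n, M) → Maps(Γ_v ⧸ U_n, M)`
because `θ̄` is (one orbit), between discrete representations. [cite: NeukirchSchmidtWingberg2008, I §6 (1.6.5)] -/
theorem bijective_cohomologyMap_coindFinPull [CompactSpace (absoluteGaloisGroup (v.adicCompletion ℚ))] (n : ℕ)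
    [Fintype (absoluteGaloisGroup ℚ ⧸ κ.layerSubgroup n)] (q : ℕ) :
    Function.Bijective (cohomologyMap (coindFinPull ρM.toTopRep (κ.layerSubgroup n)
        (resGalOfEmb (closureEmb (K := ℚ) (v.adicCompletion ℚ))) (X' := localRepOf ρM v)
        (TopRep.ofHom ⟨ContinuousLinearMap.id ℤ M, fun _ => rfl⟩) (layerGroup κ v n) (fun _ h => h)) q) := by
  letI : Fintype (absoluteGaloisGroup (v.adicCompletion ℚ) ⧸ layerGroup κ v n) := layerFintypeQuot κ v n
  haveI : DiscreteTopology (TopRep.res (resGalOfEmb (closureEmb (K := ℚ) (v.adicCompletion ℚ)) :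
      absoluteGaloisGroup (v.adicCompletion ℚ) →* absoluteGaloisGroup ℚ)
        (coindFin.{0, 0} ρM.toTopRep (κ.layerSubgroup n))) :=
    inferInstanceAs (DiscreteTopology (absoluteGaloisGroup ℚ ⧸ κ.layerSubgroup n → M))
  haveI : DiscreteTopology (coindFin.{0, 0} (localRepOf ρM v) (layerGroup κ v n)) :=
    inferInstanceAs (DiscreteTopology (absoluteGaloisGroup (v.adicCompletion ℚ) ⧸ layerGroup κ v n → M))
  refine bijective_cohomologyMap_of_bijective _ ?_ q
  set θbar := quotientPull (κ.layerSubgroup n) (resGalOfEmb (closureEmb (K := ℚ) (v.adicCompletion ℚ))) (layerGroup κ v n)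
    (fun _ h => h)
  have hbij : Function.Bijective θbar := SignedKatoOffTwo.LayerPairing.quotientPull_layerGroup_bijective κ v hκ hv n
  refine ⟨fun φ ψ h => ?_, fun g => ?_⟩
  · funext y
    obtain ⟨z, rfl⟩ := hbij.2 y
    exact congrFun h z
  · refine ⟨fun y => g ((Equiv.ofBijective θbar hbij).symm y), funext fun z => ?_⟩
    change g ((Equiv.ofBijective θbar hbij).symm (θbar z)) = g z
    rw [← Equiv.ofBijective_apply θbar hbij z, Equiv.symm_apply_apply]

/-- **Every class of `H¹(ℚ, Maps(Γ_ℚ ⧸ Γ_n, M)^D)` is `H¹(Ψ)(Sh b)` for a UNIQUE layer class `b ∈ H¹(Γ_n, M)`** (Shapiro + the self-duality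
`M ⥲ M^D`; `exists_unique_shapiroLift_coindTateDualMor_eq` with `bijective_pairingHomOfFun_flip`) — the dictionary by which dual-side Selmer
classes `y ∈ H¹_{𝓕*}(ℚ, ρc^D)` are read as layer classes. [cite: NeukirchSchmidtWingberg2008, I §6 Prop. (1.6.4)] [cite: MilneADT2006, Ch. I Cor. 2.3] -/
theorem existsUnique_shapiroLift_coindTateDual_eq [Finite M] [CompactSpace (absoluteGaloisGroup ℚ)]
    (hnondeg : ∀ T, (∀ S, e S T = 1) → T = 0) (hN : ∀ m : M, N • m = 0) (n : ℕ)
    [Fintype (absoluteGaloisGroup ℚ ⧸ κ.layerSubgroup n)]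
    {s : absoluteGaloisGroup ℚ ⧸ κ.layerSubgroup n → absoluteGaloisGroup ℚ}
    (hs : ∀ y, (s y : absoluteGaloisGroup ℚ ⧸ κ.layerSubgroup n) = y)
    (hs1 : s ((1 : absoluteGaloisGroup ℚ) : absoluteGaloisGroup ℚ ⧸ κ.layerSubgroup n) = 1)
    (y : galoisCohomology ((ρM.coind (κ.layerSubgroup n) (κ.isOpen_layerSubgroup n)).tateDual N) 1) :
    ∃! b : H1 ρM (κ.layerSubgroup n),
      cohomologyMap (coindTateDualMor ρM ρM (κ.layerSubgroup n) (pairingHomOfFun N e hμ hadd₁ hadd₂) (κ.isOpen_layerSubgroup n)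
          (fun σ S T => (contPairingOfFun ρM N e hμ hadd₁ hadd₂ hgal).toLin_smul σ S T)) 1
        (shapiroLift ρM.toTopRep (κ.layerSubgroup n) (κ.isOpen_layerSubgroup n) hs hs1 b) = y :=
  exists_unique_shapiroLift_coindTateDualMor_eq _ _ _ _ _ _ (bijective_pairingHomOfFun_flip N e hμ hadd₁ hadd₂ hnondeg hN) hs hs1 y

include hκ hv in
/-- **The dual transport `T_v : H¹(Γ_v, Maps(Γ_v ⧸ U_n, M|)) ↪ H¹(ℚ_v, Maps(Γ_ℚ ⧸ Γ_n, M)^D)`** (existence, injective, additive): for every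
local layer-model class `t` there is a dual class `T_v t` whose local Tate pairing character (THE canonical maps) is
`a' ↦ invAt_v (pull_v a' ∪_{layerSumPairingOf} t)` (`T_v = H¹(Ψ|_{Γ_v}) ∘ pull_v⁻¹`: `pull_v` bijective at `v ∣ p`, `Ψ` an isomorphism for `e`
non-degenerate; value by `localTatePairing_coind_cohomologyMap_eq_cupProduct_pull`). [cite: MilneADT2006, Ch. I Cor. 2.3, Ch. I §6 (proof of Prop. 6.9)]
[cite: Kobayashi2003, (8.23) (p. 18)] -/
theorem exists_injective_dualTransport [Finite M] [CompactSpace (absoluteGaloisGroup ℚ)]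
    [CompactSpace (absoluteGaloisGroup (v.adicCompletion ℚ))] (hnondeg : ∀ T, (∀ S, e S T = 1) → T = 0)
    (hN : ∀ m : M, N • m = 0) (n : ℕ) [Fintype (absoluteGaloisGroup ℚ ⧸ κ.layerSubgroup n)] :
    ∃ T : continuousCohomology.{0, 0, 0} 1 (coindFin.{0, 0} (localRepOf ρM v) (layerGroup κ v n)) →+
        galoisCohomology ((((ρM.coind (κ.layerSubgroup n) (κ.isOpen_layerSubgroup n)).tateDual N).toLocal (Sum.inr v))) 1,
      Function.Injective T ∧
      ∀ (t : continuousCohomology.{0, 0, 0} 1 (coindFin.{0, 0} (localRepOf ρM v) (layerGroup κ v n)))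
        (a' : galoisCohomology ((ρM.coind (κ.layerSubgroup n) (κ.isOpen_layerSubgroup n)).toLocal (Sum.inr v)) 1),
        localTatePairingZMod (ρM.coind (κ.layerSubgroup n) (κ.isOpen_layerSubgroup n)) N (Sum.inr v)
            (LocalInvariants.canonical ℚ N (Sum.inr v)) a' (T t) =
          invAt N v ((layerSumPairingOf ρM N e hμ hadd₁ hadd₂ hgal κ v n).cupProduct
            (cohomologyMap (coindFinPull ρM.toTopRep (κ.layerSubgroup n)
              (resGalOfEmb (closureEmb (K := ℚ) (v.adicCompletion ℚ))) (X' := localRepOf ρM v)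
              (TopRep.ofHom ⟨ContinuousLinearMap.id ℤ M, fun _ => rfl⟩) (layerGroup κ v n) (fun _ h => h)) 1 a')
            t) := by
  -- `Ψ|_{Γ_v}` in the spelling of the Literature lemma, and the pull equivalence
  let Ψv : TopRep.res (absGaloisRestrict ℚ (Place.Completion (Sum.inr v : Place ℚ)) :
      absoluteGaloisGroup (Place.Completion (Sum.inr v : Place ℚ)) →* absoluteGaloisGroup ℚ)
        (coindFin.{0, 0} ρM.toTopRep (κ.layerSubgroup n)) ⟶
      ((((ρM.coind (κ.layerSubgroup n) (κ.isOpen_layerSubgroup n)).tateDual N).toLocal (Sum.inr v))).toTopRep :=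
    TopRep.ofHom ⟨(coindTateDualMor ρM ρM (κ.layerSubgroup n) (pairingHomOfFun N e hμ hadd₁ hadd₂) (κ.isOpen_layerSubgroup n)
        (fun σ S T => (contPairingOfFun ρM N e hμ hadd₁ hadd₂ hgal).toLin_smul σ S T)).hom.toContinuousLinearMap, fun d =>
      (coindTateDualMor ρM ρM (κ.layerSubgroup n) (pairingHomOfFun N e hμ hadd₁ hadd₂) (κ.isOpen_layerSubgroup n)
        (fun σ S T => (contPairingOfFun ρM N e hμ hadd₁ hadd₂ hgal).toLin_smul σ S T)).hom.isIntertwining'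
          (absGaloisRestrict ℚ (Place.Completion (Sum.inr v : Place ℚ)) d)⟩
  have hΨv : Function.Injective (cohomologyMap Ψv 1) := by
    haveI : DiscreteTopology (TopRep.res (absGaloisRestrict ℚ (Place.Completion (Sum.inr v : Place ℚ)) :
        absoluteGaloisGroup (Place.Completion (Sum.inr v : Place ℚ)) →* absoluteGaloisGroup ℚ)
          (coindFin.{0, 0} ρM.toTopRep (κ.layerSubgroup n))) :=
      inferInstanceAs (DiscreteTopology (absoluteGaloisGroup ℚ ⧸ κ.layerSubgroup n → M))
    haveI : DiscreteTopology (((ρM.coind (κ.layerSubgroup n) (κ.isOpen_layerSubgroup n)).tateDual N).toLocal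
        (Sum.inr v)).toTopRep :=
      inferInstanceAs (DiscreteTopology (TateDual ℚ (absoluteGaloisGroup ℚ ⧸ κ.layerSubgroup n → M) N))
    refine (bijective_cohomologyMap_of_bijective Ψv ?_ 1).1
    exact coindTateDualHom_bijective (κ.layerSubgroup n) (pairingHomOfFun N e hμ hadd₁ hadd₂)
      (bijective_pairingHomOfFun_flip N e hμ hadd₁ hadd₂ hnondeg hN)
  let PM := coindFinPull ρM.toTopRep (κ.layerSubgroup n)
    (resGalOfEmb (closureEmb (K := ℚ) (v.adicCompletion ℚ))) (X' := localRepOf ρM v)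
    (TopRep.ofHom ⟨ContinuousLinearMap.id ℤ M, fun _ => rfl⟩) (layerGroup κ v n) (fun _ h => h)
  have hpull : Function.Bijective ((cohomologyMap PM 1).hom.toLinearMap.toAddMonoidHom) :=
    bijective_cohomologyMap_coindFinPull ρM κ v hκ hv n 1
  let Epull := AddEquiv.ofBijective _ hpull
  refine ⟨(cohomologyMap Ψv 1).hom.toLinearMap.toAddMonoidHom.comp Epull.symm.toAddMonoidHom,
    hΨv.comp Epull.symm.injective, fun t a' => ?_⟩
  obtain ⟨t', rfl⟩ := hpull.2 t
  have hsymm : Epull.symm ((cohomologyMap PM 1).hom.toLinearMap.toAddMonoidHom t') = t' := Epull.symm_apply_apply t'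
  -- the one-orbit data at `v ∣ p`, pre-elaborated in the `Place.Completion` spelling of the Literature lemma
  have hU' : ∀ d : absoluteGaloisGroup (Place.Completion (Sum.inr v : Place ℚ)),
      d ∈ (layerGroup κ v n : Subgroup (absoluteGaloisGroup (Place.Completion (Sum.inr v : Place ℚ)))) →
        absGaloisRestrict ℚ (Place.Completion (Sum.inr v : Place ℚ)) d ∈ κ.layerSubgroup n := fun _ h => h
  have hbij : Function.Bijective (quotientPull (κ.layerSubgroup n) (absGaloisRestrict ℚ (Place.Completion (Sum.inr v : Place ℚ)))
      (layerGroup κ v n : Subgroup (absoluteGaloisGroup (Place.Completion (Sum.inr v : Place ℚ)))) hU') :=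
    SignedKatoOffTwo.LayerPairing.quotientPull_layerGroup_bijective κ v hκ hv n
  have key := @localTatePairing_coind_cohomologyMap_eq_cupProduct_pull ℚ _ _ _ _ _ _ _ _ _ _
    ρM ρM (κ.layerSubgroup n) _ N (pairingHomOfFun N e hμ hadd₁ hadd₂) (κ.isOpen_layerSubgroup n)
    (fun σ S T => (contPairingOfFun ρM N e hμ hadd₁ hadd₂ hgal).toLin_smul σ S T) _ (Sum.inr v) (layerGroup κ v n)
    hU' (layerFintypeQuot κ v n) hbij a' t'
  rw [localTatePairingZMod_apply]
  exact (congrArg (fun x => LocalInvariants.canonical ℚ N (Sum.inr v) (localTatePairing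
      (ρM.coind (κ.layerSubgroup n) (κ.isOpen_layerSubgroup n)) N (Sum.inr v) a'
        (cohomologyMap Ψv 1 x))) hsymm).trans
    (congrArg (LocalInvariants.canonical ℚ N (Sum.inr v)) key)

include hκ hv in
/-- **Non-degeneracy of the layer pairing (local Tate duality for `ℚ_{n,v}` in the Shapiro model, `v ∣ p`)**: a class
`t ∈ H¹(Γ_v, Maps(Γ_v ⧸ U_n, M|))` with `invAt_v (pull_v a' ∪_{layerSumPairingOf} t) = 0` for every `a' ∈ H¹(ℚ_v, Maps(Γ_ℚ ⧸ Γ_n, M))` is `0` —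
from `IsPerfect` of THE canonical family on `Maps(Γ_ℚ ⧸ Γ_n, M)` (`LocalInvariants.canonical_isPerfect`) through the dual transport. With
`pull_v` onto (`bijective_cohomologyMap_coindFinPull`) this says: `layerPairingH1Of … x y = 0` for all `x` forces `y = 0` once both are read
through `layerShapiroOf`. [cite: MilneADT2006, Ch. I Cor. 2.3] [cite: Kobayashi2003, (8.23) (p. 18)] -/
theorem eq_zero_of_forall_invAt_cupProduct_pull_eq_zero [Finite M] [CompactSpace (absoluteGaloisGroup ℚ)]
    [CompactSpace (absoluteGaloisGroup (v.adicCompletion ℚ))] (hnondeg : ∀ T, (∀ S, e S T = 1) → T = 0)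
    (hN : ∀ m : M, N • m = 0) (n : ℕ) [Fintype (absoluteGaloisGroup ℚ ⧸ κ.layerSubgroup n)]
    (t : continuousCohomology.{0, 0, 0} 1 (coindFin.{0, 0} (localRepOf ρM v) (layerGroup κ v n)))
    (ht : ∀ a' : galoisCohomology ((ρM.coind (κ.layerSubgroup n) (κ.isOpen_layerSubgroup n)).toLocal (Sum.inr v)) 1,
      invAt N v ((layerSumPairingOf ρM N e hμ hadd₁ hadd₂ hgal κ v n).cupProduct
        (cohomologyMap (coindFinPull ρM.toTopRep (κ.layerSubgroup n)
          (resGalOfEmb (closureEmb (K := ℚ) (v.adicCompletion ℚ))) (X' := localRepOf ρM v)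
          (TopRep.ofHom ⟨ContinuousLinearMap.id ℤ M, fun _ => rfl⟩) (layerGroup κ v n) (fun _ h => h)) 1 a')
        t) = 0) :
    t = 0 := by
  obtain ⟨T, hT, hTpair⟩ := exists_injective_dualTransport ρM N e hμ hadd₁ hadd₂ hgal κ v hκ hv hnondeg hN n
  have hM : ∀ m : absoluteGaloisGroup ℚ ⧸ κ.layerSubgroup n → M, N • m = 0 := fun φ =>
    funext fun y => hN (φ y)
  have hperf := (LocalInvariants.canonical_isPerfect (K := ℚ) (n := N) v).2
    (ρM.coind (κ.layerSubgroup n) (κ.isOpen_layerSubgroup n)) hM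
  have h0 : T t = 0 := by
    apply hperf.2.1
    ext a'
    rw [AddMonoidHom.flip_apply, AddMonoidHom.flip_apply, hTpair, ht, map_zero]
  exact hT (by rw [h0, map_zero])

end ThetaTransport.CoindShapiroOfFun

end Summit.BirchSwinnertonDyer.BirchSwinnertonDyer.Theorems

end
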